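import Literature.Analysis.SpecialFunctions.GegenbauerHeatJets
import Literature.Analysis.PDE.HamiltonHarnackRadialSphereFour
import Mathlib.Analysis.SpecialFunctions.Log.Deriv
import Mathlib.Analysis.SpecialFunctions.Trigonometric.Deriv
import Mathlib.Analysis.Convex.Deriv
import HarnessLib

/-!
# Hamilton's Harnack inequality and logarithmic convexity for the positive polynomial heat flow
# of `S⁴`

For the ultraspherical polynomial heat flow `V = gegenbauerHeat 1 b J` of
`GegenbauerHeatPositivity.lean` (a finite Gegenbauer sum solving the radial heat equation of the
round `S⁴`, `∂_τ V = (1-s²)∂²ₛV - 4s∂ₛV`, `s = cos θ`) which is POSITIVE on `[-1,1] × [0,T]`: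

* `harnack_gegenbauerHeat_one` — R. S. Hamilton's matrix Harnack inequality in radial form,
  `(1-s²)F₂ - sF₁ + 1/(2τ) ≥ 0` and `-sF₁ + 1/(2τ) ≥ 0` on `[-1,1] × (0,T]` (`F = log V`), by
  `Literature.Analysis.PDE.harnack_of_radial_heat_jets` fed with the jets of
  `GegenbauerHeatJets.lean`;
* `convexOn_log_gegenbauerHeat_one` — hence, for `0 < τ ≤ T`, **`θ ↦ log V(cos θ, τ) + θ²/(4τ)`
  is convex on `ℝ`** (its second derivative is `(1-s²)F₂ - sF₁ + 1/(2τ)` at `s = cos θ`):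
  Hamilton's corollary "`log f + s²/4t` is convex along every geodesic" (Comm. Anal. Geom. 1
  (1993), p. 114) for these radial solutions on `S⁴`.

The passage to the zonal heat kernel of `S⁴` (`J → ∞`) is in
`Literature/Geometry/Riemannian/SphericalZonalHamiltonHarnack.lean`.  Everything is proved; no
named facts.

## References
* R. S. Hamilton, *A matrix Harnack estimate for the heat equation*, Comm. Anal. Geom. 1 (1993)
  113–126, Main Theorem and p. 114. [Hamilton1993Harnack]
-/

noncomputable section

open Set Filter
open scoped Topology

namespace Literature.Analysis.SpecialFunctions

/-- **Hamilton's matrix Harnack inequality for the positive polynomial heat flow of `S⁴`**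
(radial form): if `V = gegenbauerHeat 1 b J > 0` on `[-1,1] × [0,T]` then, with `F = log V`,
`(1-s²)∂²ₛF - s∂ₛF + 1/(2τ) ≥ 0` and `-s∂ₛF + 1/(2τ) ≥ 0` on `[-1,1] × (0,T]`.
[cite: Hamilton1993Harnack, Main Theorem (radial solutions on S⁴)] -/
theorem harnack_gegenbauerHeat_one {b : ℕ → ℝ} {J : ℕ} {T : ℝ}
    (hpos : ∀ s ∈ Icc (-1 : ℝ) 1, ∀ τ ∈ Icc (0 : ℝ) T, 0 < gegenbauerHeat 1 b J s τ) :
    ∀ s ∈ Icc (-1 : ℝ) 1, ∀ τ ∈ Ioc (0 : ℝ) T,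
      0 ≤ (1 - s ^ 2) * (gegenbauerHeatDss 1 b J s τ * (gegenbauerHeat 1 b J s τ)⁻¹
              - gegenbauerHeatDs 1 b J s τ ^ 2 * (gegenbauerHeat 1 b J s τ)⁻¹ ^ 2)
            - s * (gegenbauerHeatDs 1 b J s τ * (gegenbauerHeat 1 b J s τ)⁻¹) + 1 / (2 * τ) ∧
        0 ≤ -s * (gegenbauerHeatDs 1 b J s τ * (gegenbauerHeat 1 b J s τ)⁻¹) + 1 / (2 * τ) := by
  refine Literature.Analysis.PDE.harnack_of_radial_heat_jets
    (u0 := gegenbauerHeat 1 b J) (u1 := gegenbauerHeatDs 1 b J) (u2 := gegenbauerHeatDss 1 b J)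
    (u3 := gegenbauerHeatDsss 1 b J) (u4 := gegenbauerHeatDssss 1 b J)
    (hasDerivAt_gegenbauerHeat_s 1 b J) (hasDerivAt_gegenbauerHeatDs_s 1 b J)
    (hasDerivAt_gegenbauerHeatDss_s 1 b J) (hasDerivAt_gegenbauerHeatDsss_s 1 b J)
    (fun s τ => (hasDerivAt_gegenbauerHeat_t_pde 1 b J s τ).congr_deriv (by push_cast; ring))
    (fun s τ => (hasDerivAt_gegenbauerHeatDs_t 1 b J s τ).congr_deriv (by push_cast; ring))
    (fun s τ => (hasDerivAt_gegenbauerHeatDss_t 1 b J s τ).congr_deriv (by push_cast; ring))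
    (continuous_gegenbauerHeat 1 b J) (continuous_gegenbauerHeatDs 1 b J)
    (continuous_gegenbauerHeatDss 1 b J) hpos

/-- A function with explicit first and second derivatives everywhere, the second non-negative,
is convex on `ℝ`. [folklore] -/
theorem convexOn_univ_of_hasDerivAt2_nonneg {f f' f'' : ℝ → ℝ} (hf : ∀ x, HasDerivAt f (f' x) x)
    (hf' : ∀ x, HasDerivAt f' (f'' x) x) (hnn : ∀ x, 0 ≤ f'' x) : ConvexOn ℝ univ f := by
  have hd : deriv f = f' := funext fun x => (hf x).deriv
  have hd' : deriv f' = f'' := funext fun x => (hf' x).deriv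
  refine convexOn_univ_of_deriv2_nonneg (fun x => (hf x).differentiableAt) ?_ ?_
  · rw [hd]; exact fun x => (hf' x).differentiableAt
  · intro x
    simp only [Function.iterate_succ, Function.iterate_zero, Function.comp_apply, Function.id_def,
      hd, hd']
    exact hnn x

/-- **Logarithmic convexity along geodesics (Hamilton) for the positive polynomial heat flow of
`S⁴`**: if `V = gegenbauerHeat 1 b J > 0` on `[-1,1] × [0,T]` and `0 < τ ≤ T`, then
`θ ↦ log V(cos θ, τ) + θ²/(4τ)` is convex on `ℝ`.
[cite: Hamilton1993Harnack, p. 114 (log f + s²/4t is convex along geodesics)] -/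
theorem convexOn_log_gegenbauerHeat_one {b : ℕ → ℝ} {J : ℕ} {T : ℝ}
    (hpos : ∀ s ∈ Icc (-1 : ℝ) 1, ∀ τ ∈ Icc (0 : ℝ) T, 0 < gegenbauerHeat 1 b J s τ)
    {τ : ℝ} (hτ : τ ∈ Ioc (0 : ℝ) T) :
    ConvexOn ℝ univ
      (fun θ : ℝ => Real.log (gegenbauerHeat 1 b J (Real.cos θ) τ) + θ ^ 2 / (4 * τ)) := by
  set V : ℝ → ℝ := fun x => gegenbauerHeat 1 b J x τ with hV
  set V1 : ℝ → ℝ := fun x => gegenbauerHeatDs 1 b J x τ with hV1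
  set V2 : ℝ → ℝ := fun x => gegenbauerHeatDss 1 b J x τ with hV2
  have hcos : ∀ θ : ℝ, Real.cos θ ∈ Icc (-1 : ℝ) 1 := fun θ => ⟨Real.neg_one_le_cos θ, Real.cos_le_one θ⟩
  have hτ' : τ ∈ Icc (0 : ℝ) T := ⟨hτ.1.le, hτ.2⟩
  have hVpos : ∀ θ : ℝ, 0 < V (Real.cos θ) := fun θ => hpos _ (hcos θ) τ hτ'
  have hτ0 : τ ≠ 0 := hτ.1.ne'
  -- derivatives of `V` and of `F₁ = V₁/V` in `s`
  have hVd : ∀ x, HasDerivAt V (V1 x) x := fun x => hasDerivAt_gegenbauerHeat_s 1 b J x τ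
  have hV1d : ∀ x, HasDerivAt V1 (V2 x) x := fun x => hasDerivAt_gegenbauerHeatDs_s 1 b J x τ
  have hF1d : ∀ x, V x ≠ 0 → HasDerivAt (fun y => V1 y * (V y)⁻¹)
      (V2 x * (V x)⁻¹ - V1 x ^ 2 * (V x)⁻¹ ^ 2) x := by
    intro x hne
    have hw : HasDerivAt (fun y => (V y)⁻¹) (-V1 x * (V x)⁻¹ ^ 2) x := by
      refine ((hVd x).inv hne).congr_deriv ?_
      simp only [inv_pow, div_eq_mul_inv, neg_mul]
    exact Literature.Analysis.PDE.hasDerivAt_logJet1 hw (hV1d x)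
  -- the function, its first and second derivatives in `θ`
  set f : ℝ → ℝ := fun θ => Real.log (V (Real.cos θ)) + θ ^ 2 / (4 * τ) with hf
  set f' : ℝ → ℝ := fun θ => -Real.sin θ * (V1 (Real.cos θ) * (V (Real.cos θ))⁻¹) + θ / (2 * τ)
    with hf'
  set f'' : ℝ → ℝ := fun θ => -Real.cos θ * (V1 (Real.cos θ) * (V (Real.cos θ))⁻¹)
    + Real.sin θ ^ 2 * (V2 (Real.cos θ) * (V (Real.cos θ))⁻¹
      - V1 (Real.cos θ) ^ 2 * (V (Real.cos θ))⁻¹ ^ 2) + 1 / (2 * τ) with hf''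
  have hfd : ∀ θ, HasDerivAt f (f' θ) θ := by
    intro θ
    have h1 : HasDerivAt (fun x => V (Real.cos x)) (V1 (Real.cos θ) * -Real.sin θ) θ :=
      (hVd (Real.cos θ)).comp θ (Real.hasDerivAt_cos θ)
    have h2 := h1.log (hVpos θ).ne'
    have h3 : HasDerivAt (fun x : ℝ => x ^ 2 / (4 * τ)) (2 * θ / (4 * τ)) θ := by
      simpa using (hasDerivAt_pow 2 θ).div_const (4 * τ)
    refine (h2.add h3).congr_deriv ?_
    simp only [hf']
    field_simp
    ring
  have hf'd : ∀ θ, HasDerivAt f' (f'' θ) θ := by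
    intro θ
    have h1 : HasDerivAt (fun x => V1 (Real.cos x) * (V (Real.cos x))⁻¹)
        ((V2 (Real.cos θ) * (V (Real.cos θ))⁻¹ - V1 (Real.cos θ) ^ 2 * (V (Real.cos θ))⁻¹ ^ 2)
          * -Real.sin θ) θ :=
      (hF1d (Real.cos θ) (hVpos θ).ne').comp θ (Real.hasDerivAt_cos θ)
    have h2 := (Real.hasDerivAt_sin θ).neg.fun_mul h1
    have h3 : HasDerivAt (fun x : ℝ => x / (2 * τ)) (1 / (2 * τ)) θ :=
      (hasDerivAt_id' θ).div_const (2 * τ)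
    refine (h2.add h3).congr_deriv ?_
    simp only [hf'', Pi.neg_apply]
    ring
  -- the second derivative is Hamilton's Harnack quantity at `s = cos θ`
  have hnn : ∀ θ, 0 ≤ f'' θ := by
    intro θ
    have h := (harnack_gegenbauerHeat_one hpos (Real.cos θ) (hcos θ) τ hτ).1
    simp only [hf'', Real.sin_sq θ]
    nlinarith [h]
  exact convexOn_univ_of_hasDerivAt2_nonneg hfd hf'd hnn

end Literature.Analysis.SpecialFunctions
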